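import Mathlib
import HarnessLib
import Summits.NavierStokesRegularity.NavierStokesRegularity.Theorems.UnthreadedRigidityDoorUnthreadedRigidityVirialHornTwoChannelRadial

/-!
# Route `UnthreadedRigidityDoor`, item `UnthreadedRigidity` (W2, stmt-NavierStokesRegularity-27585) — LINE g11-1 «VIRIAL HORN»,
# BRIDGE V for PLATEAU PROFILES («TWO-CHANNEL RIGIDITY»), file 4a: SMOOTHNESS AND DECAY OF THE SOURCE CHANNELS FROM `VirialAdmissible`

Prover file (W2 Lean hand ns-crc-p1 g10, by lineage; `--supports stmt-NavierStokesRegularity-27585 --as helper`; objects BY NAME in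
`Theorems/UnthreadedRigidityDoorUnthreadedRigidityVirialHornTwoChannelDefs.lean`, p726708 / p728780 and its second append).

Content: smoothness in `s` of `ampA`, `chanG`, `chanY`, `cascadeSrc`; the scaled jet of a virial-admissible profile (`scaledJet_bounds`:
`r^{l+3}H′ + (l+1)r^{l+2}H`, `(r^{l+4}H″ + (l+2)r^{l+3}H′)/2`, `l r^{l+3}H′`, `l(r^{l+4}H″ − r^{l+3}H′)/2` are bounded by `(l+3)C`); the SCALED
IDENTITIES `chanY_sq_scaled`, `chanG_sq_scaled`, `ampA_sq_scaled` (`r^{2l+8}·chanY(r²)`, `r^{2l+6}·chanG(r²)`, `r^{2l+4}·ampA(r²)²` are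
quadratic forms in the scaled jet, every `r > 0`); ★ channel decay from the three clauses of `VirialAdmissible` LITERALLY:
`|chanY| ≤ K/σ^{l+4}`, `|chanG| ≤ K/σ^{l+3}`, `|ampA²| ≤ K/σ^{l+2}` on `[1,∞)` (box bound on the scaled identities).
HONEST LABEL: slice-level calculus / real analysis about SPECIAL (separable) data; a piece of the L-part of ONE bridge of a RUNG line on the
wall item; `UnthreadedRigidity` (27585), W2 and NS regularity remain OPEN; nothing here is a statement about Navier–Stokes regularity.  0 kit.
-/

-- the summit and its single sub-problem share the name (CONVENTIONS §1), as in every Theorems file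
set_option linter.dupNamespace false

namespace Summit.NavierStokesRegularity.NavierStokesRegularity.Theorems.UnthreadedRigidity.VirialHorn

open scoped RealInnerProductSpace Topology Laplacian
open Filter Set MvPolynomial
open Literature.Combinatorics.LorentzianPolynomials (pderiv_pderiv_comm)
open Summit.NavierStokesRegularity.NavierStokesRegularity.Theorems.UnthreadedRigidity.ProfileHorn (E3)
open Summit.NavierStokesRegularity.NavierStokesRegularity.Theorems.UnthreadedRigidity.HornPressure (radCoeff)
open Summit.NavierStokesRegularity.NavierStokesRegularity.Theorems.PoloidalLiouville.HorizonTower hiding E3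

/-! ## §5 The channels and the radial cascade of a virial-admissible profile -/

section Coeff

open scoped ContDiff
open Summit.NavierStokesRegularity.NavierStokesRegularity.Theorems.UnthreadedRigidity.HornPressure (radCoeff_ode')

variable {l : ℕ} {H h : ℝ → ℝ} {C : ℝ}

/-- the strain amplitude channel is smooth in `s`. -/
theorem contDiff_ampA (hh : ContDiff ℝ ∞ h) (l : ℕ) : ContDiff ℝ ∞ (ampA l h) := by
  have hd : ContDiff ℝ ∞ (deriv h) := contDiff_deriv_of_contDiff_top hh
  have : ampA l h = fun s => 2 * s * deriv h s + ((l : ℝ) + 1) * h s := rfl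
  rw [this]
  exact ((contDiff_const.mul contDiff_id).mul hd).add (contDiff_const.mul hh)

/-- the `|∇Y|²`-channel is smooth in `s`. -/
theorem contDiff_chanG (hh : ContDiff ℝ ∞ h) (l : ℕ) : ContDiff ℝ ∞ (chanG l h) := by
  have hd : ContDiff ℝ ∞ (deriv h) := contDiff_deriv_of_contDiff_top hh
  have hd2 : ContDiff ℝ ∞ (deriv (deriv h)) := contDiff_deriv_of_contDiff_top hd
  have hA : ContDiff ℝ ∞ (fun s : ℝ => 2 * s * deriv h s + ((l : ℝ) + 1) * h s) :=
    ((contDiff_const.mul contDiff_id).mul hd).add (contDiff_const.mul hh)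
  have hA' : ContDiff ℝ ∞ (fun s : ℝ => ((l : ℝ) + 3) * deriv h s + 2 * s * deriv (deriv h) s) :=
    (contDiff_const.mul hd).add ((contDiff_const.mul contDiff_id).mul hd2)
  have hB : ContDiff ℝ ∞ (fun s : ℝ => 2 * (l : ℝ) * deriv h s) := contDiff_const.mul hd
  have : chanG l h = fun s => 4 * ((l : ℝ) - 1) * (2 * s * deriv h s + ((l : ℝ) + 1) * h s)
      * (((l : ℝ) + 3) * deriv h s + 2 * s * deriv (deriv h) s)
      - 4 * s * (((l : ℝ) + 3) * deriv h s + 2 * s * deriv (deriv h) s) * (2 * (l : ℝ) * deriv h s)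
      - 2 * ((l : ℝ) - 1) * (2 * s * deriv h s + ((l : ℝ) + 1) * h s) * (2 * (l : ℝ) * deriv h s) := rfl
  rw [this]
  exact (((contDiff_const.mul hA).mul hA').sub (((contDiff_const.mul contDiff_id).mul hA').mul hB)).sub
    ((contDiff_const.mul hA).mul hB)

/-- the `Y²`-channel is smooth in `s`. -/
theorem contDiff_chanY (hh : ContDiff ℝ ∞ h) (l : ℕ) : ContDiff ℝ ∞ (chanY l h) := by
  have hd : ContDiff ℝ ∞ (deriv h) := contDiff_deriv_of_contDiff_top hh
  have hd2 : ContDiff ℝ ∞ (deriv (deriv h)) := contDiff_deriv_of_contDiff_top hd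
  have hA : ContDiff ℝ ∞ (fun s : ℝ => 2 * s * deriv h s + ((l : ℝ) + 1) * h s) :=
    ((contDiff_const.mul contDiff_id).mul hd).add (contDiff_const.mul hh)
  have hA' : ContDiff ℝ ∞ (fun s : ℝ => ((l : ℝ) + 3) * deriv h s + 2 * s * deriv (deriv h) s) :=
    (contDiff_const.mul hd).add ((contDiff_const.mul contDiff_id).mul hd2)
  have hB : ContDiff ℝ ∞ (fun s : ℝ => 2 * (l : ℝ) * deriv h s) := contDiff_const.mul hd
  have hB' : ContDiff ℝ ∞ (fun s : ℝ => 2 * (l : ℝ) * deriv (deriv h) s) := contDiff_const.mul hd2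
  have hs : ContDiff ℝ ∞ (fun s : ℝ => s) := contDiff_id
  have : chanY l h = fun s => 4 * (l : ℝ) ^ 2 * (((l : ℝ) + 3) * deriv h s + 2 * s * deriv (deriv h) s) ^ 2
      + 4 * s ^ 2 * (2 * (l : ℝ) * deriv (deriv h) s) ^ 2
      + ((l : ℝ) ^ 2 + 2 * l + 3) * (2 * (l : ℝ) * deriv h s) ^ 2
      - 8 * (l : ℝ) * s * (((l : ℝ) + 3) * deriv h s + 2 * s * deriv (deriv h) s) * (2 * (l : ℝ) * deriv (deriv h) s)
      - 4 * (l : ℝ) * (((l : ℝ) + 3) * deriv h s + 2 * s * deriv (deriv h) s) * (2 * (l : ℝ) * deriv h s)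
      - 4 * (l : ℝ) * ((l : ℝ) - 1) * (2 * s * deriv h s + ((l : ℝ) + 1) * h s) * (2 * (l : ℝ) * deriv (deriv h) s)
      + 4 * ((l : ℝ) + 1) * s * (2 * (l : ℝ) * deriv h s) * (2 * (l : ℝ) * deriv (deriv h) s) := rfl
  rw [this]
  exact ((((((contDiff_const.mul (hA'.pow 2)).add ((contDiff_const.mul (hs.pow 2)).mul (hB'.pow 2))).add
    (contDiff_const.mul (hB.pow 2))).sub (((contDiff_const.mul hs).mul hA').mul hB')).sub
    ((contDiff_const.mul hA').mul hB)).sub ((contDiff_const.mul hA).mul hB')).add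
    (((contDiff_const.mul hs).mul hB).mul hB')

/-- every level of the source is smooth in `s`. -/
theorem contDiff_cascadeSrc (hh : ContDiff ℝ ∞ h) (l k : ℕ) : ContDiff ℝ ∞ (cascadeSrc l h k) := by
  match k with
  | 0 => exact contDiff_chanY hh l
  | 1 =>
    show ContDiff ℝ ∞ (fun s => chanG l h s / 2)
    exact (contDiff_chanG hh l).div_const 2
  | 2 =>
    show ContDiff ℝ ∞ (fun s => ampA l h s ^ 2 / 4)
    exact ((contDiff_ampA hh l).pow 2).div_const 4
  | k + 3 =>
    show ContDiff ℝ ∞ (fun _ : ℝ => (0 : ℝ))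
    exact contDiff_const

/-- nonnegativity of the decay constant of `VirialAdmissible`. -/
theorem virialConst_nonneg
    (hC : ∀ r : ℝ, 1 ≤ r → r ^ (l + 2) * |H r| ≤ C ∧ r ^ (l + 3) * |deriv H r| ≤ C ∧ r ^ (l + 4) * |deriv (deriv H) r| ≤ C) :
    0 ≤ C :=
  le_trans (by positivity) (hC 1 le_rfl).1

/-- THE SCALED JET of the profile at `r ≥ 1`: the four linear quantities
`A_t = r^{l+3}H′ + (l+1)r^{l+2}H`, `A′_t = (r^{l+4}H″ + (l+2)r^{l+3}H′)/2`, `B_t = l r^{l+3}H′`, `B′_t = l(r^{l+4}H″ − r^{l+3}H′)/2`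
are all bounded by `(l+3)·C`. -/
theorem scaledJet_bounds (hl : 1 ≤ l)
    (hC : ∀ r : ℝ, 1 ≤ r → r ^ (l + 2) * |H r| ≤ C ∧ r ^ (l + 3) * |deriv H r| ≤ C ∧ r ^ (l + 4) * |deriv (deriv H) r| ≤ C)
    {r : ℝ} (hr : 1 ≤ r) :
    |r ^ (l + 3) * deriv H r + ((l : ℝ) + 1) * (r ^ (l + 2) * H r)| ≤ ((l : ℝ) + 3) * C ∧
    |(r ^ (l + 4) * deriv (deriv H) r + ((l : ℝ) + 2) * (r ^ (l + 3) * deriv H r)) / 2| ≤ ((l : ℝ) + 3) * C ∧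
    |(l : ℝ) * (r ^ (l + 3) * deriv H r)| ≤ ((l : ℝ) + 3) * C ∧
    |(l : ℝ) * (r ^ (l + 4) * deriv (deriv H) r - r ^ (l + 3) * deriv H r) / 2| ≤ ((l : ℝ) + 3) * C := by
  have hC0 := virialConst_nonneg hC
  obtain ⟨h0, h1, h2⟩ := hC r hr
  have hr0 : 0 < r := by linarith
  have e0 : |r ^ (l + 2) * H r| ≤ C := by rwa [abs_mul, abs_of_pos (pow_pos hr0 _)]
  have e1 : |r ^ (l + 3) * deriv H r| ≤ C := by rwa [abs_mul, abs_of_pos (pow_pos hr0 _)]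
  have e2 : |r ^ (l + 4) * deriv (deriv H) r| ≤ C := by rwa [abs_mul, abs_of_pos (pow_pos hr0 _)]
  have hl1 : (1 : ℝ) ≤ l := by exact_mod_cast hl
  refine ⟨?_, ?_, ?_, ?_⟩
  · have f1 : |((l : ℝ) + 1) * (r ^ (l + 2) * H r)| ≤ ((l : ℝ) + 1) * C := by
      rw [abs_mul, abs_of_nonneg (by positivity : (0:ℝ) ≤ (l : ℝ) + 1)]
      exact mul_le_mul_of_nonneg_left e0 (by positivity)
    calc |r ^ (l + 3) * deriv H r + ((l : ℝ) + 1) * (r ^ (l + 2) * H r)|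
        ≤ |r ^ (l + 3) * deriv H r| + |((l : ℝ) + 1) * (r ^ (l + 2) * H r)| := abs_add_le _ _
      _ ≤ C + ((l : ℝ) + 1) * C := add_le_add e1 f1
      _ ≤ ((l : ℝ) + 3) * C := by nlinarith
  · rw [abs_div, abs_two]
    have f1 : |((l : ℝ) + 2) * (r ^ (l + 3) * deriv H r)| ≤ ((l : ℝ) + 2) * C := by
      rw [abs_mul, abs_of_nonneg (by positivity : (0:ℝ) ≤ (l : ℝ) + 2)]
      exact mul_le_mul_of_nonneg_left e1 (by positivity)
    calc |r ^ (l + 4) * deriv (deriv H) r + ((l : ℝ) + 2) * (r ^ (l + 3) * deriv H r)| / 2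
        ≤ (|r ^ (l + 4) * deriv (deriv H) r| + |((l : ℝ) + 2) * (r ^ (l + 3) * deriv H r)|) / 2 :=
          div_le_div_of_nonneg_right (abs_add_le _ _) zero_le_two
      _ ≤ (C + ((l : ℝ) + 2) * C) / 2 := div_le_div_of_nonneg_right (add_le_add e2 f1) zero_le_two
      _ ≤ ((l : ℝ) + 3) * C := by nlinarith
  · rw [abs_mul, abs_of_nonneg (by positivity : (0:ℝ) ≤ (l : ℝ))]
    calc (l : ℝ) * |r ^ (l + 3) * deriv H r| ≤ (l : ℝ) * C := mul_le_mul_of_nonneg_left e1 (by positivity)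
      _ ≤ ((l : ℝ) + 3) * C := by nlinarith
  · rw [abs_div, abs_two, abs_mul, abs_of_nonneg (by positivity : (0:ℝ) ≤ (l : ℝ))]
    calc (l : ℝ) * |r ^ (l + 4) * deriv (deriv H) r - r ^ (l + 3) * deriv H r| / 2
        ≤ (l : ℝ) * (|r ^ (l + 4) * deriv (deriv H) r| + |r ^ (l + 3) * deriv H r|) / 2 :=
          div_le_div_of_nonneg_right (mul_le_mul_of_nonneg_left (abs_sub _ _) (by positivity)) zero_le_two
      _ ≤ (l : ℝ) * (C + C) / 2 :=
          div_le_div_of_nonneg_right (mul_le_mul_of_nonneg_left (add_le_add e2 e1) (by positivity)) zero_le_two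
      _ ≤ ((l : ℝ) + 3) * C := by nlinarith

/-- the `s`-derivatives of the even profile at `s = r²`, `r > 0`, in terms of `H′(r)`, `H″(r)`. -/
theorem deriv_h_sq_eq (hh : ContDiff ℝ ∞ h) (hHh : ∀ r : ℝ, 0 ≤ r → H r = h (r ^ 2)) {r : ℝ} (hr : 0 < r) :
    deriv h (r ^ 2) = deriv H r / (2 * r) ∧
    deriv (deriv h) (r ^ 2) = (deriv (deriv H) r - deriv H r / r) / (4 * r ^ 2) := by
  have h1 := deriv_profile_of_sq hh hHh hr
  have h2 := deriv_deriv_profile_of_sq hh hHh hr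
  have hr0 : r ≠ 0 := hr.ne'
  constructor
  · rw [h1]; field_simp
  · rw [h2, h1]; field_simp; ring

/-- a quadratic term is bounded by the box: `|x| ≤ D`, `|y| ≤ D` ⇒ `|x y| ≤ D²`. -/
theorem abs_mul_le_sq {x y D : ℝ} (hx : |x| ≤ D) (hy : |y| ≤ D) : |x * y| ≤ D ^ 2 := by
  rw [abs_mul, sq]
  exact mul_le_mul hx hy (abs_nonneg _) ((abs_nonneg _).trans hx)

/-- THE SCALED IDENTITY of the `Y²`-channel (every `r > 0`): `r^{2l+8}·chanY(r²)` is a quadratic form in the scaled jet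
`A_t = r^{l+3}H′ + (l+1)r^{l+2}H`, `A′_t = (r^{l+4}H″ + (l+2)r^{l+3}H′)/2`, `B_t = l r^{l+3}H′`, `B′_t = l(r^{l+4}H″ − r^{l+3}H′)/2`. -/
theorem chanY_sq_scaled (hh : ContDiff ℝ ∞ h) (hHh : ∀ r : ℝ, 0 ≤ r → H r = h (r ^ 2)) (l : ℕ) {r : ℝ} (hr : 0 < r) :
    r ^ (2 * l + 8) * chanY l h (r ^ 2) =
      4 * (l : ℝ) ^ 2 * (((r ^ (l + 4) * deriv (deriv H) r + ((l : ℝ) + 2) * (r ^ (l + 3) * deriv H r)) / 2)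
          * ((r ^ (l + 4) * deriv (deriv H) r + ((l : ℝ) + 2) * (r ^ (l + 3) * deriv H r)) / 2))
      + 4 * (((l : ℝ) * (r ^ (l + 4) * deriv (deriv H) r - r ^ (l + 3) * deriv H r) / 2)
          * ((l : ℝ) * (r ^ (l + 4) * deriv (deriv H) r - r ^ (l + 3) * deriv H r) / 2))
      + ((l : ℝ) ^ 2 + 2 * l + 3) * (((l : ℝ) * (r ^ (l + 3) * deriv H r)) * ((l : ℝ) * (r ^ (l + 3) * deriv H r)))
      - 8 * (l : ℝ) * (((r ^ (l + 4) * deriv (deriv H) r + ((l : ℝ) + 2) * (r ^ (l + 3) * deriv H r)) / 2)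
          * ((l : ℝ) * (r ^ (l + 4) * deriv (deriv H) r - r ^ (l + 3) * deriv H r) / 2))
      - 4 * (l : ℝ) * (((r ^ (l + 4) * deriv (deriv H) r + ((l : ℝ) + 2) * (r ^ (l + 3) * deriv H r)) / 2)
          * ((l : ℝ) * (r ^ (l + 3) * deriv H r)))
      - 4 * (l : ℝ) * ((l : ℝ) - 1) * ((r ^ (l + 3) * deriv H r + ((l : ℝ) + 1) * (r ^ (l + 2) * H r))
          * ((l : ℝ) * (r ^ (l + 4) * deriv (deriv H) r - r ^ (l + 3) * deriv H r) / 2))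
      + 4 * ((l : ℝ) + 1) * (((l : ℝ) * (r ^ (l + 3) * deriv H r))
          * ((l : ℝ) * (r ^ (l + 4) * deriv (deriv H) r - r ^ (l + 3) * deriv H r) / 2)) := by
  obtain ⟨d1, d2⟩ := deriv_h_sq_eq hh hHh hr
  simp only [chanY, d1, d2, hHh r hr.le]
  have hr0' : r ≠ 0 := hr.ne'
  field_simp
  ring

/-- THE SCALED IDENTITY of the `|∇Y|²`-channel: `r^{2l+6}·chanG(r²) = 4(l−1)A_tA′_t − 4A′_tB_t − 2(l−1)A_tB_t`. -/
theorem chanG_sq_scaled (hh : ContDiff ℝ ∞ h) (hHh : ∀ r : ℝ, 0 ≤ r → H r = h (r ^ 2)) (l : ℕ) {r : ℝ} (hr : 0 < r) :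
    r ^ (2 * l + 6) * chanG l h (r ^ 2) =
      4 * ((l : ℝ) - 1) * ((r ^ (l + 3) * deriv H r + ((l : ℝ) + 1) * (r ^ (l + 2) * H r))
          * ((r ^ (l + 4) * deriv (deriv H) r + ((l : ℝ) + 2) * (r ^ (l + 3) * deriv H r)) / 2))
      - 4 * (((r ^ (l + 4) * deriv (deriv H) r + ((l : ℝ) + 2) * (r ^ (l + 3) * deriv H r)) / 2)
          * ((l : ℝ) * (r ^ (l + 3) * deriv H r)))
      - 2 * ((l : ℝ) - 1) * ((r ^ (l + 3) * deriv H r + ((l : ℝ) + 1) * (r ^ (l + 2) * H r))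
          * ((l : ℝ) * (r ^ (l + 3) * deriv H r))) := by
  obtain ⟨d1, d2⟩ := deriv_h_sq_eq hh hHh hr
  simp only [chanG, d1, d2, hHh r hr.le]
  have hr0' : r ≠ 0 := hr.ne'
  field_simp
  ring

/-- THE SCALED IDENTITY of the Hessian channel: `r^{2l+4}·ampA(r²)² = A_t²`. -/
theorem ampA_sq_scaled (hh : ContDiff ℝ ∞ h) (hHh : ∀ r : ℝ, 0 ≤ r → H r = h (r ^ 2)) (l : ℕ) {r : ℝ} (hr : 0 < r) :
    r ^ (2 * l + 4) * ampA l h (r ^ 2) ^ 2 =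
      (r ^ (l + 3) * deriv H r + ((l : ℝ) + 1) * (r ^ (l + 2) * H r))
        * (r ^ (l + 3) * deriv H r + ((l : ℝ) + 1) * (r ^ (l + 2) * H r)) := by
  obtain ⟨d1, -⟩ := deriv_h_sq_eq hh hHh hr
  simp only [ampA, d1, hHh r hr.le]
  have hr0' : r ≠ 0 := hr.ne'
  field_simp
  ring

/-- ★ DECAY OF THE `Y²`-CHANNEL: `|chanY l h σ| ≤ K/σ^{l+4}` on `[1,∞)` for a virial-admissible profile. -/
theorem abs_chanY_le (hl : 1 ≤ l) (hh : ContDiff ℝ ∞ h) (hHh : ∀ r : ℝ, 0 ≤ r → H r = h (r ^ 2))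
    (hC : ∀ r : ℝ, 1 ≤ r → r ^ (l + 2) * |H r| ≤ C ∧ r ^ (l + 3) * |deriv H r| ≤ C ∧ r ^ (l + 4) * |deriv (deriv H) r| ≤ C) :
    ∃ K : ℝ, ∀ σ : ℝ, 1 ≤ σ → |chanY l h σ| ≤ K / σ ^ (l + 4) := by
  set D := ((l : ℝ) + 3) * C with hD
  refine ⟨(4 * (l : ℝ) ^ 2 + 4 + ((l : ℝ) ^ 2 + 2 * l + 3) + 8 * l + 4 * l + 4 * l * ((l : ℝ) - 1) + 4 * ((l : ℝ) + 1)) * D ^ 2,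
    fun σ hσ => ?_⟩
  have hσ0 : 0 < σ := by linarith
  set r := Real.sqrt σ with hr
  have hr1 : 1 ≤ r := by rw [hr, ← Real.sqrt_one]; exact Real.sqrt_le_sqrt hσ
  have hr0 : 0 < r := by linarith
  have hrs : r ^ 2 = σ := Real.sq_sqrt hσ0.le
  have hl1 : (1 : ℝ) ≤ l := by exact_mod_cast hl
  obtain ⟨bA, bA', bB, bB'⟩ := scaledJet_bounds hl hC hr1
  obtain ⟨d1, d2⟩ := deriv_h_sq_eq hh hHh hr0
  -- the scaled identity
  set At := r ^ (l + 3) * deriv H r + ((l : ℝ) + 1) * (r ^ (l + 2) * H r)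
  set A't := (r ^ (l + 4) * deriv (deriv H) r + ((l : ℝ) + 2) * (r ^ (l + 3) * deriv H r)) / 2
  set Bt := (l : ℝ) * (r ^ (l + 3) * deriv H r)
  set B't := (l : ℝ) * (r ^ (l + 4) * deriv (deriv H) r - r ^ (l + 3) * deriv H r) / 2
  have hid : r ^ (2 * l + 8) * chanY l h (r ^ 2) =
      4 * (l : ℝ) ^ 2 * (A't * A't) + 4 * (B't * B't) + ((l : ℝ) ^ 2 + 2 * l + 3) * (Bt * Bt)
        - 8 * (l : ℝ) * (A't * B't) - 4 * (l : ℝ) * (A't * Bt) - 4 * (l : ℝ) * ((l : ℝ) - 1) * (At * B't)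
        + 4 * ((l : ℝ) + 1) * (Bt * B't) := by
    simp only [At, A't, Bt, B't, chanY, d1, d2, hHh r hr0.le]
    have hr0' : r ≠ 0 := hr0.ne'
    field_simp
    ring
  have t1 : |4 * (l : ℝ) ^ 2 * (A't * A't)| ≤ 4 * (l : ℝ) ^ 2 * D ^ 2 := by
    rw [abs_mul, abs_of_nonneg (by positivity : (0:ℝ) ≤ 4 * (l : ℝ) ^ 2)]
    exact mul_le_mul_of_nonneg_left (abs_mul_le_sq bA' bA') (by positivity)
  have t2 : |4 * (B't * B't)| ≤ 4 * D ^ 2 := by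
    rw [abs_mul, abs_of_nonneg (by positivity : (0:ℝ) ≤ 4)]
    exact mul_le_mul_of_nonneg_left (abs_mul_le_sq bB' bB') (by positivity)
  have t3 : |((l : ℝ) ^ 2 + 2 * l + 3) * (Bt * Bt)| ≤ ((l : ℝ) ^ 2 + 2 * l + 3) * D ^ 2 := by
    rw [abs_mul, abs_of_nonneg (by positivity : (0:ℝ) ≤ (l : ℝ) ^ 2 + 2 * l + 3)]
    exact mul_le_mul_of_nonneg_left (abs_mul_le_sq bB bB) (by positivity)
  have t4 : |8 * (l : ℝ) * (A't * B't)| ≤ 8 * (l : ℝ) * D ^ 2 := by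
    rw [abs_mul, abs_of_nonneg (by positivity : (0:ℝ) ≤ 8 * (l : ℝ))]
    exact mul_le_mul_of_nonneg_left (abs_mul_le_sq bA' bB') (by positivity)
  have t5 : |4 * (l : ℝ) * (A't * Bt)| ≤ 4 * (l : ℝ) * D ^ 2 := by
    rw [abs_mul, abs_of_nonneg (by positivity : (0:ℝ) ≤ 4 * (l : ℝ))]
    exact mul_le_mul_of_nonneg_left (abs_mul_le_sq bA' bB) (by positivity)
  have t6 : |4 * (l : ℝ) * ((l : ℝ) - 1) * (At * B't)| ≤ 4 * (l : ℝ) * ((l : ℝ) - 1) * D ^ 2 := by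
    have hnn : (0:ℝ) ≤ 4 * (l : ℝ) * ((l : ℝ) - 1) := by nlinarith
    rw [abs_mul, abs_of_nonneg hnn]
    exact mul_le_mul_of_nonneg_left (abs_mul_le_sq bA bB') hnn
  have t7 : |4 * ((l : ℝ) + 1) * (Bt * B't)| ≤ 4 * ((l : ℝ) + 1) * D ^ 2 := by
    rw [abs_mul, abs_of_nonneg (by positivity : (0:ℝ) ≤ 4 * ((l : ℝ) + 1))]
    exact mul_le_mul_of_nonneg_left (abs_mul_le_sq bB bB') (by positivity)
  have key : |r ^ (2 * l + 8) * chanY l h (r ^ 2)| ≤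
      (4 * (l : ℝ) ^ 2 + 4 + ((l : ℝ) ^ 2 + 2 * l + 3) + 8 * l + 4 * l + 4 * l * ((l : ℝ) - 1) + 4 * ((l : ℝ) + 1)) * D ^ 2 := by
    rw [hid]
    rw [abs_le] at t1 t2 t3 t4 t5 t6 t7 ⊢
    constructor <;> linarith [t1.1, t1.2, t2.1, t2.2, t3.1, t3.2, t4.1, t4.2, t5.1, t5.2, t6.1, t6.2, t7.1, t7.2]
  rw [← hrs, ← pow_mul, show 2 * (l + 4) = 2 * l + 8 by ring, le_div_iff₀ (pow_pos hr0 _), mul_comm]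
  rw [abs_mul, abs_of_pos (pow_pos hr0 _)] at key
  exact key

/-- ★ DECAY OF THE `|∇Y|²`-CHANNEL: `|chanG l h σ| ≤ K/σ^{l+3}` on `[1,∞)`. -/
theorem abs_chanG_le (hl : 1 ≤ l) (hh : ContDiff ℝ ∞ h) (hHh : ∀ r : ℝ, 0 ≤ r → H r = h (r ^ 2))
    (hC : ∀ r : ℝ, 1 ≤ r → r ^ (l + 2) * |H r| ≤ C ∧ r ^ (l + 3) * |deriv H r| ≤ C ∧ r ^ (l + 4) * |deriv (deriv H) r| ≤ C) :
    ∃ K : ℝ, ∀ σ : ℝ, 1 ≤ σ → |chanG l h σ| ≤ K / σ ^ (l + 3) := by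
  set D := ((l : ℝ) + 3) * C with hD
  refine ⟨(4 * ((l : ℝ) - 1) + 4 + 2 * ((l : ℝ) - 1)) * D ^ 2, fun σ hσ => ?_⟩
  have hσ0 : 0 < σ := by linarith
  set r := Real.sqrt σ with hr
  have hr1 : 1 ≤ r := by rw [hr, ← Real.sqrt_one]; exact Real.sqrt_le_sqrt hσ
  have hr0 : 0 < r := by linarith
  have hrs : r ^ 2 = σ := Real.sq_sqrt hσ0.le
  have hl1 : (1 : ℝ) ≤ l := by exact_mod_cast hl
  obtain ⟨bA, bA', bB, -⟩ := scaledJet_bounds hl hC hr1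
  obtain ⟨d1, d2⟩ := deriv_h_sq_eq hh hHh hr0
  set At := r ^ (l + 3) * deriv H r + ((l : ℝ) + 1) * (r ^ (l + 2) * H r)
  set A't := (r ^ (l + 4) * deriv (deriv H) r + ((l : ℝ) + 2) * (r ^ (l + 3) * deriv H r)) / 2
  set Bt := (l : ℝ) * (r ^ (l + 3) * deriv H r)
  have hid : r ^ (2 * l + 6) * chanG l h (r ^ 2) =
      4 * ((l : ℝ) - 1) * (At * A't) - 4 * (A't * Bt) - 2 * ((l : ℝ) - 1) * (At * Bt) := by
    simp only [At, A't, Bt, chanG, d1, d2, hHh r hr0.le]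
    have hr0' : r ≠ 0 := hr0.ne'
    field_simp
    ring
  have hnn : (0:ℝ) ≤ (l : ℝ) - 1 := by linarith
  have t1 : |4 * ((l : ℝ) - 1) * (At * A't)| ≤ 4 * ((l : ℝ) - 1) * D ^ 2 := by
    rw [abs_mul, abs_of_nonneg (by positivity : (0:ℝ) ≤ 4 * ((l : ℝ) - 1))]
    exact mul_le_mul_of_nonneg_left (abs_mul_le_sq bA bA') (by positivity)
  have t2 : |4 * (A't * Bt)| ≤ 4 * D ^ 2 := by
    rw [abs_mul, abs_of_nonneg (by positivity : (0:ℝ) ≤ 4)]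
    exact mul_le_mul_of_nonneg_left (abs_mul_le_sq bA' bB) (by positivity)
  have t3 : |2 * ((l : ℝ) - 1) * (At * Bt)| ≤ 2 * ((l : ℝ) - 1) * D ^ 2 := by
    rw [abs_mul, abs_of_nonneg (by positivity : (0:ℝ) ≤ 2 * ((l : ℝ) - 1))]
    exact mul_le_mul_of_nonneg_left (abs_mul_le_sq bA bB) (by positivity)
  have key : |r ^ (2 * l + 6) * chanG l h (r ^ 2)| ≤ (4 * ((l : ℝ) - 1) + 4 + 2 * ((l : ℝ) - 1)) * D ^ 2 := by
    rw [hid]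
    rw [abs_le] at t1 t2 t3 ⊢
    constructor <;> linarith [t1.1, t1.2, t2.1, t2.2, t3.1, t3.2]
  rw [← hrs, ← pow_mul, show 2 * (l + 3) = 2 * l + 6 by ring, le_div_iff₀ (pow_pos hr0 _), mul_comm]
  rw [abs_mul, abs_of_pos (pow_pos hr0 _)] at key
  exact key

/-- ★ DECAY OF THE HESSIAN CHANNEL: `|ampA l h σ|² ≤ K/σ^{l+2}` on `[1,∞)`. -/
theorem abs_ampA_sq_le (hl : 1 ≤ l) (hh : ContDiff ℝ ∞ h) (hHh : ∀ r : ℝ, 0 ≤ r → H r = h (r ^ 2))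
    (hC : ∀ r : ℝ, 1 ≤ r → r ^ (l + 2) * |H r| ≤ C ∧ r ^ (l + 3) * |deriv H r| ≤ C ∧ r ^ (l + 4) * |deriv (deriv H) r| ≤ C) :
    ∃ K : ℝ, ∀ σ : ℝ, 1 ≤ σ → |ampA l h σ ^ 2| ≤ K / σ ^ (l + 2) := by
  set D := ((l : ℝ) + 3) * C with hD
  refine ⟨D ^ 2, fun σ hσ => ?_⟩
  have hσ0 : 0 < σ := by linarith
  set r := Real.sqrt σ with hr
  have hr1 : 1 ≤ r := by rw [hr, ← Real.sqrt_one]; exact Real.sqrt_le_sqrt hσ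
  have hr0 : 0 < r := by linarith
  have hrs : r ^ 2 = σ := Real.sq_sqrt hσ0.le
  obtain ⟨bA, -, -, -⟩ := scaledJet_bounds hl hC hr1
  obtain ⟨d1, -⟩ := deriv_h_sq_eq hh hHh hr0
  set At := r ^ (l + 3) * deriv H r + ((l : ℝ) + 1) * (r ^ (l + 2) * H r)
  have hid : r ^ (2 * l + 4) * ampA l h (r ^ 2) ^ 2 = At * At := by
    simp only [At, ampA, d1, hHh r hr0.le]
    have hr0' : r ≠ 0 := hr0.ne'
    field_simp
    ring
  have key : |r ^ (2 * l + 4) * ampA l h (r ^ 2) ^ 2| ≤ D ^ 2 := by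
    rw [hid]; exact abs_mul_le_sq bA bA
  rw [← hrs, ← pow_mul, show 2 * (l + 2) = 2 * l + 4 by ring, le_div_iff₀ (pow_pos hr0 _), mul_comm]
  rw [abs_mul, abs_of_pos (pow_pos hr0 _)] at key
  exact key

end Coeff

end Summit.NavierStokesRegularity.NavierStokesRegularity.Theorems.UnthreadedRigidity.VirialHorn
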